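import Mathlib
import Literature.Analysis.FluidPDE.CompressibleEulerImplosionSonicSeriesGrowthB
import Literature.Analysis.FluidPDE.CompressibleEulerImplosionSonicSeriesBall
import Literature.Analysis.FluidPDE.CompressibleEulerImplosionSonicCoeffWindow2B
import HarnessLib

/-!
# Buckmaster–Cao-Labora–Gómez-Serrano at γ = 5/3: certified tails of the sonic series on `|x| ≤ 1/20`, window `r ∈ [13890041/12500000, 697/625]`

Sequel of `…SonicSeriesGrowthB` (the growth lemma: `|w_j| ≤ MAJAW2[j]10^j/2^64`, `|z_j| ≤ MAJBW2[j]10^j/2^64` for `j ≤ 200`,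
`Θ/j³·10^j` beyond) and `…SonicSeriesBall` (`HasSum` of the series on `10|x| < 1`). For the consumers of the r-uniform sonic engine
(start values of the near-sonic barriers at `x = ±1/20`, evaluations of the pinned profile `W = −(Wloc+Zloc)/2`, `S = (Wloc−Zloc)/6` and of
its derivative near `P_s`) this file turns the coefficient bounds into TAIL BOUNDS after the 26 kernel-certified head coefficients
(`…SonicCoeffWindow2B.tmem_LSW2`), uniformly in `r` on the window and in `|x| ≤ 1/20`:

* `hasSum_deriv_of_geom_bound` — termwise differentiation of `Σ aₙxⁿ` on the OPEN disc `M|x| < 1` (the tree's `hasSum_deriv_term` only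
  reaches `|x| < 1/(2M)`);
* `abs_Wloc_sub_head_le`, `abs_Zloc_sub_head_le` — `|Wloc r x − Σ_{j<26} w_j x^j| ≤ tailWQ = 2.0e-15`, `… ≤ tailZQ = 3.1e-13`;
* `abs_deriv_Wloc_sub_head_le`, `abs_deriv_Zloc_sub_head_le` — `|(Wloc r)′ x − Σ_{j<25} (j+1) w_{j+1} x^j| ≤ dtailWQ = 1.0e-12`,
  `… ≤ dtailZQ = 1.7e-10`;

the four constants being exact rationals summed in the kernel from `MAJAW2/MAJBW2` (orders 26…200) plus the closed-form geometric remainder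
of the `Θ/j³` tail; and finally the r-UNIFORM START BOXES: `tscaleQ/headValTM/headDerTM` (Taylor-model evaluation of the certified head
`LWSW2/LZSW2` at a rational `c`, `|c| ≤ 1/20`) and `tmem_WZloc_val`, `tmem_deriv_WZloc_val` — Taylor models in `ρ = r − r_m` (degree 10,
scale `2^100`) of `Wloc r c`, `Zloc r c`, `(Wloc r)′ c`, `(Zloc r)′ c` valid on the whole window (the tail folded into the constant
coefficient by `tmem_widen0`). No facts, no axioms. [cite: BuckmasterCaolaboraGomezserrano2025, Prop. 2.3, App. B]
-/

noncomputable section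

open Filter Set Metric Topology Finset

namespace Literature.Analysis.FluidPDE

namespace BuckmasterCaolaboraGomezserrano2025

namespace Monatomic

namespace SonicSeries

set_option linter.style.longLine false
set_option linter.style.setOption false
set_option maxRecDepth 100000
set_option maxHeartbeats 4000000

/-! ### Termwise differentiation on the open disc -/

section Generic

variable {a : ℕ → ℝ} {K M : ℝ}

/-- **Termwise differentiation of `Σ aₙ xⁿ` on the open disc `M|x| < 1`.** [folklore] -/
theorem hasDerivAt_tsum_of_geom_bound (hM : 0 < M) (ha : ∀ n, |a n| ≤ K * M ^ n) {x : ℝ} (hx : M * |x| < 1) :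
    HasDerivAt (fun y => ∑' n, a n * y ^ n) (∑' n, a n * ((n : ℝ) * x ^ (n - 1))) x := by
  -- adapted from `hasDerivAt_tsum_term`: work on the ball of radius `ρ = (|x| + 1/M)/2`, where `Mρ < 1`
  have hK : 0 ≤ K := by have := (abs_nonneg _).trans (ha 0); simpa using this
  set ρ : ℝ := (|x| + 1 / M) / 2 with hρ
  have hxρ : |x| < ρ := by
    have : |x| < 1 / M := by rw [lt_div_iff₀ hM]; linarith
    rw [hρ]; linarith
  have hρ0 : 0 < ρ := lt_of_le_of_lt (abs_nonneg x) hxρ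
  have hθ : M * ρ < 1 := by
    have : M * (1 / M) = 1 := by field_simp
    rw [hρ]; nlinarith
  have hθ0 : 0 ≤ M * ρ := by positivity
  set u : ℕ → ℝ := fun n => K / ρ * ((n : ℝ) * (M * ρ) ^ n) with hu
  have hu_sum : Summable u := by
    have h1 : Summable fun n : ℕ => (n : ℝ) ^ 1 * (M * ρ) ^ n :=
      summable_pow_mul_geometric_of_norm_lt_one 1 (by rw [Real.norm_of_nonneg hθ0]; exact hθ)
    simp only [pow_one] at h1
    exact h1.mul_left (K / ρ)
  have hball : ∀ y : ℝ, y ∈ Metric.ball (0 : ℝ) ρ → |y| ≤ ρ := fun y hy => by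
    rw [Metric.mem_ball, Real.dist_eq, sub_zero] at hy; exact hy.le
  have hg' : ∀ (n : ℕ) (y : ℝ), y ∈ Metric.ball (0 : ℝ) ρ → ‖a n * ((n : ℝ) * y ^ (n - 1))‖ ≤ u n := by
    intro n y hy
    have hy' := hball y hy
    rw [Real.norm_eq_abs]
    rcases Nat.eq_zero_or_pos n with rfl | hn
    · simp [hu]
    obtain ⟨m, rfl⟩ : ∃ m, n = m + 1 := ⟨n - 1, by omega⟩
    simp only [hu, Nat.add_sub_cancel]
    rw [abs_mul, abs_mul, abs_pow, abs_of_nonneg (by positivity : (0:ℝ) ≤ ((m + 1 : ℕ) : ℝ))]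
    have hρne : ρ ≠ 0 := hρ0.ne'
    calc |a (m + 1)| * ((((m + 1 : ℕ)) : ℝ) * |y| ^ m)
        ≤ K * M ^ (m + 1) * ((((m + 1 : ℕ)) : ℝ) * ρ ^ m) := by
          gcongr; exact ha (m + 1)
      _ = K / ρ * ((((m + 1 : ℕ)) : ℝ) * (M * ρ) ^ (m + 1)) := by
          rw [mul_pow, pow_succ, pow_succ]; field_simp
  have hg : ∀ (n : ℕ) (y : ℝ), y ∈ Metric.ball (0 : ℝ) ρ →
      HasDerivAt (fun x => a n * x ^ n) (a n * ((n : ℝ) * y ^ (n - 1))) y :=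
    fun n y _ => (hasDerivAt_pow n y).const_mul (a n)
  have h0 : (0 : ℝ) ∈ Metric.ball (0 : ℝ) ρ := Metric.mem_ball_self hρ0
  have hsum0 : Summable fun n => a n * (0 : ℝ) ^ n :=
    (hasSum_of_geom_bound hM ha (x := 0) (by simp)).summable
  have hx' : x ∈ Metric.ball (0 : ℝ) ρ := by simpa [Real.dist_eq] using hxρ
  exact hasDerivAt_tsum_of_isPreconnected hu_sum Metric.isOpen_ball
    (convex_ball (0 : ℝ) ρ).isPreconnected hg hg' h0 hsum0 hx'

/-- **`HasSum ((n+1) aₙ₊₁ xⁿ) ((Σ aₙ yⁿ)′(x))` on the open disc `M|x| < 1`.** [folklore] -/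
theorem hasSum_deriv_of_geom_bound (hM : 0 < M) (ha : ∀ n, |a n| ≤ K * M ^ n) {x : ℝ} (hx : M * |x| < 1) :
    HasSum (fun n : ℕ => ((n : ℝ) + 1) * a (n + 1) * x ^ n) (deriv (fun y => ∑' n, a n * y ^ n) x) := by
  rw [(hasDerivAt_tsum_of_geom_bound hM ha hx).deriv]
  -- the derivative series is summable at `x` (bound by the summable majorant on a slightly larger radius)
  have hK : 0 ≤ K := by have := (abs_nonneg _).trans (ha 0); simpa using this
  have hs : Summable fun n => a n * ((n : ℝ) * x ^ (n - 1)) := by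
    set ρ : ℝ := (|x| + 1 / M) / 2 with hρ
    have hxρ : |x| ≤ ρ := by
      have : |x| < 1 / M := by rw [lt_div_iff₀ hM]; linarith
      rw [hρ]; linarith
    have hρ0 : 0 < ρ := by
      have : 0 < 1 / M := by positivity
      rw [hρ]; linarith [abs_nonneg x]
    have hθ : M * ρ < 1 := by
      have : M * (1 / M) = 1 := by field_simp
      rw [hρ]; nlinarith
    have hθ0 : 0 ≤ M * ρ := by positivity
    have h1 : Summable fun n : ℕ => (n : ℝ) ^ 1 * (M * ρ) ^ n :=
      summable_pow_mul_geometric_of_norm_lt_one 1 (by rw [Real.norm_of_nonneg hθ0]; exact hθ)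
    simp only [pow_one] at h1
    refine Summable.of_norm_bounded (h1.mul_left (K / ρ)) fun n => ?_
    rw [Real.norm_eq_abs]
    rcases Nat.eq_zero_or_pos n with rfl | hn
    · simp
    obtain ⟨m, rfl⟩ : ∃ m, n = m + 1 := ⟨n - 1, by omega⟩
    simp only [Nat.add_sub_cancel]
    rw [abs_mul, abs_mul, abs_pow, abs_of_nonneg (by positivity : (0:ℝ) ≤ ((m + 1 : ℕ) : ℝ))]
    calc |a (m + 1)| * ((((m + 1 : ℕ)) : ℝ) * |x| ^ m)
        ≤ K * M ^ (m + 1) * ((((m + 1 : ℕ)) : ℝ) * ρ ^ m) := by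
          gcongr; exact ha (m + 1)
      _ = K / ρ * ((((m + 1 : ℕ)) : ℝ) * (M * ρ) ^ (m + 1)) := by
          rw [mul_pow, pow_succ, pow_succ]; field_simp
  have h2 := (hasSum_nat_add_iff' 1).mpr hs.hasSum
  simp only [sum_range_one, Nat.cast_zero, zero_mul, mul_zero, sub_zero] at h2
  refine h2.congr_fun fun n => ?_
  simp only [Nat.add_sub_cancel, Nat.cast_succ]
  ring

/-- The tail after `N` terms: `|s − Σ_{j<N} fⱼ| ≤ B` when `|fⱼ| ≤ gⱼ` (`j ≥ N`) and `Σ_{i} g_{N+i} = B`. [folklore] -/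
theorem abs_sub_partial_le {f g : ℕ → ℝ} {N : ℕ} {s B : ℝ} (hf : HasSum f s) (hg : ∀ j, N ≤ j → |f j| ≤ g j)
    (hB : HasSum (fun i => g (i + N)) B) : |s - ∑ j ∈ range N, f j| ≤ B := by
  have h := (hasSum_nat_add_iff' N).mpr hf
  have := HasSum.norm_le_of_bounded h hB fun i => by rw [Real.norm_eq_abs]; exact hg _ (by omega)
  rwa [Real.norm_eq_abs] at this

/-- A bound sequence made of finitely many data terms followed by a geometric sequence sums to the finite sum plus the
geometric remainder. [folklore] -/
theorem hasSum_data_then_geometric (d : ℕ → ℝ) (L : ℕ) (c θ : ℝ) (hθ0 : 0 ≤ θ) (hθ1 : θ < 1) :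
    HasSum (fun i => if i < L then d i else c * θ ^ i) ((∑ i ∈ range L, d i) + c * θ ^ L / (1 - θ)) := by
  set g : ℕ → ℝ := fun i => if i < L then d i else c * θ ^ i with hg
  have h1 : HasSum (fun i => g (i + L)) (c * θ ^ L / (1 - θ)) := by
    have hgeo := hasSum_geometric_of_lt_one hθ0 hθ1
    have := hgeo.mul_left (c * θ ^ L)
    refine this.congr_fun fun i => ?_
    simp only [hg, if_neg (show ¬ (i + L < L) by omega), pow_add]
    ring_nf
  have h1' : HasSum (fun i => g (i + L)) (((∑ i ∈ range L, g i) + c * θ ^ L / (1 - θ)) - ∑ i ∈ range L, g i) := by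
    rwa [add_sub_cancel_left]
  have h2 := (hasSum_nat_add_iff' L).mp h1'
  have hfin : ∑ i ∈ range L, g i = ∑ i ∈ range L, d i :=
    sum_congr rfl fun i hi => by rw [Finset.mem_range] at hi; simp only [hg, if_pos hi]
  rw [hfin] at h2
  exact h2

end Generic

/-! ### The four tail constants on `|x| ≤ 1/20` -/

namespace SW2

open OriginSeries.CentreW2 (sumQ sumQ_eq sumQ_cast)

/-- Tail of `Σ w_j x^j` after 26 terms, `|x| ≤ 1/20`: `Σ_{26≤j≤200} MAJAW2[j]2^{-64}2^{-j} + (1/800)/201³·2^{-201}·2`. [folklore] -/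
def tailWQ : ℚ := sumQ (fun i => hAQ (i + 26) * (1 / 2) ^ (i + 26)) 175 + 1 / 800 / 201 ^ 3 * (1 / 2) ^ 201 * 2
/-- Tail of `Σ z_j x^j` after 26 terms, `|x| ≤ 1/20`. [folklore] -/
def tailZQ : ℚ := sumQ (fun i => hBQ (i + 26) * (1 / 2) ^ (i + 26)) 175 + 7 / 20 / 201 ^ 3 * (1 / 2) ^ 201 * 2
/-- Tail of `Σ (j+1) w_{j+1} x^j` after 25 terms, `|x| ≤ 1/20`. [folklore] -/
def dtailWQ : ℚ := sumQ (fun i => (((i : ℚ) + 26) * hAQ (i + 26) * 10) * (1 / 2) ^ (i + 25)) 175 + 10 * (1 / 800) / 201 ^ 2 * (1 / 2) ^ 200 * 2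
/-- Tail of `Σ (j+1) z_{j+1} x^j` after 25 terms, `|x| ≤ 1/20`. [folklore] -/
def dtailZQ : ℚ := sumQ (fun i => (((i : ℚ) + 26) * hBQ (i + 26) * 10) * (1 / 2) ^ (i + 25)) 175 + 10 * (7 / 20) / 201 ^ 2 * (1 / 2) ^ 200 * 2

/-- The constants are below `2.0e-15`, `3.1e-13`, `1.0e-12`, `1.7e-10`. [folklore] -/
theorem tails_small : tailWQ ≤ 2 / 10 ^ 15 ∧ tailZQ ≤ 31 / 10 ^ 14 ∧ dtailWQ ≤ 1 / 10 ^ 12 ∧ dtailZQ ≤ 17 / 10 ^ 11 := by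
  refine ⟨?_, ?_, ?_, ?_⟩ <;> decide +kernel

variable {r : ℝ}

/-- Termwise bound of the value series beyond order 26 at `|x| ≤ 1/20`. [folklore] -/
theorem abs_term_le_boundW (hr : r ∈ Set.Icc ((13890041/12500000 : ℚ) : ℝ) ((697/625 : ℚ) : ℝ)) {x : ℝ} (hx : |x| ≤ 1 / 20)
    {j : ℕ} (hj : 26 ≤ j) :
    |w r j * x ^ j| ≤ (if j - 26 < 175 then ((hAQ j : ℚ) : ℝ) * (1 / 2) ^ j else 1 / 800 / 201 ^ 3 * (1 / 2) ^ j) ∧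
    |z r j * x ^ j| ≤ (if j - 26 < 175 then ((hBQ j : ℚ) : ℝ) * (1 / 2) ^ j else 7 / 20 / 201 ^ 3 * (1 / 2) ^ j) := by
  have hxj : |x| ^ j ≤ (1 / 20 : ℝ) ^ j := pow_le_pow_left₀ (abs_nonneg x) hx j
  have e10 : (10 : ℝ) ^ j * (1 / 20) ^ j = (1 / 2) ^ j := by rw [← mul_pow]; norm_num
  rw [abs_mul, abs_mul, abs_pow]
  split_ifs with h
  · have hj200 : j ≤ 200 := by omega
    obtain ⟨hw, hz⟩ := abs_wz_le_MAJW2 hr hj200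
    have ew : (getN MAJAW2 j : ℝ) * ((10 : ℝ) ^ j / (2 : ℝ) ^ 64) = ((hAQ j : ℚ) : ℝ) * (10 : ℝ) ^ j := by
      unfold hAQ; push_cast; ring
    have ez : (getN MAJBW2 j : ℝ) * ((10 : ℝ) ^ j / (2 : ℝ) ^ 64) = ((hBQ j : ℚ) : ℝ) * (10 : ℝ) ^ j := by
      unfold hBQ; push_cast; ring
    rw [ew] at hw; rw [ez] at hz
    have hA0 : (0 : ℝ) ≤ ((hAQ j : ℚ) : ℝ) := by unfold hAQ; push_cast; positivity
    have hB0 : (0 : ℝ) ≤ ((hBQ j : ℚ) : ℝ) := by unfold hBQ; push_cast; positivity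
    constructor
    · calc |w r j| * |x| ^ j ≤ (((hAQ j : ℚ) : ℝ) * (10 : ℝ) ^ j) * (1 / 20 : ℝ) ^ j :=
            mul_le_mul hw hxj (by positivity) (by positivity)
        _ = _ := by rw [mul_assoc, e10]
    · calc |z r j| * |x| ^ j ≤ (((hBQ j : ℚ) : ℝ) * (10 : ℝ) ^ j) * (1 / 20 : ℝ) ^ j :=
            mul_le_mul hz hxj (by positivity) (by positivity)
        _ = _ := by rw [mul_assoc, e10]
  · have hj60 : 60 < j := by omega
    obtain ⟨hw, hz⟩ := abs_wz_le_tail hr hj60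
    have hj3 : (201 : ℝ) ^ 3 ≤ (j : ℝ) ^ 3 := by
      have : (201 : ℝ) ≤ j := by exact_mod_cast (by omega : 201 ≤ j)
      exact pow_le_pow_left₀ (by norm_num) this 3
    have hjpos : (0 : ℝ) < (j : ℝ) ^ 3 := by positivity
    have kw : (1 / 800 : ℝ) / (j : ℝ) ^ 3 ≤ 1 / 800 / 201 ^ 3 := div_le_div_of_nonneg_left (by norm_num) (by positivity) hj3
    have kz : (7 / 20 : ℝ) / (j : ℝ) ^ 3 ≤ 7 / 20 / 201 ^ 3 := div_le_div_of_nonneg_left (by norm_num) (by positivity) hj3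
    constructor
    · calc |w r j| * |x| ^ j ≤ ((1 / 800 : ℝ) / (j : ℝ) ^ 3 * (10 : ℝ) ^ j) * (1 / 20 : ℝ) ^ j :=
            mul_le_mul hw hxj (by positivity) (by positivity)
        _ = (1 / 800 : ℝ) / (j : ℝ) ^ 3 * ((10 : ℝ) ^ j * (1 / 20) ^ j) := by ring
        _ ≤ 1 / 800 / 201 ^ 3 * ((10 : ℝ) ^ j * (1 / 20) ^ j) := mul_le_mul_of_nonneg_right kw (by positivity)
        _ = _ := by rw [e10]
    · calc |z r j| * |x| ^ j ≤ ((7 / 20 : ℝ) / (j : ℝ) ^ 3 * (10 : ℝ) ^ j) * (1 / 20 : ℝ) ^ j :=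
            mul_le_mul hz hxj (by positivity) (by positivity)
        _ = (7 / 20 : ℝ) / (j : ℝ) ^ 3 * ((10 : ℝ) ^ j * (1 / 20) ^ j) := by ring
        _ ≤ 7 / 20 / 201 ^ 3 * ((10 : ℝ) ^ j * (1 / 20) ^ j) := mul_le_mul_of_nonneg_right kz (by positivity)
        _ = _ := by rw [e10]

/-- Termwise bound of the derivative series beyond order 25 at `|x| ≤ 1/20`. [folklore] -/
theorem abs_dterm_le_boundW (hr : r ∈ Set.Icc ((13890041/12500000 : ℚ) : ℝ) ((697/625 : ℚ) : ℝ)) {x : ℝ} (hx : |x| ≤ 1 / 20)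
    {j : ℕ} (hj : 25 ≤ j) :
    |((j : ℝ) + 1) * w r (j + 1) * x ^ j| ≤
      (if j - 25 < 175 then (((j : ℝ) + 1) * ((hAQ (j + 1) : ℚ) : ℝ) * 10) * (1 / 2) ^ j else 10 * (1 / 800) / 201 ^ 2 * (1 / 2) ^ j) ∧
    |((j : ℝ) + 1) * z r (j + 1) * x ^ j| ≤
      (if j - 25 < 175 then (((j : ℝ) + 1) * ((hBQ (j + 1) : ℚ) : ℝ) * 10) * (1 / 2) ^ j else 10 * (7 / 20) / 201 ^ 2 * (1 / 2) ^ j) := by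
  have hxj : |x| ^ j ≤ (1 / 20 : ℝ) ^ j := pow_le_pow_left₀ (abs_nonneg x) hx j
  have e10 : (10 : ℝ) ^ (j + 1) * (1 / 20) ^ j = 10 * (1 / 2) ^ j := by
    rw [pow_succ, show (10 : ℝ) ^ j * 10 * (1 / 20) ^ j = 10 * ((10 : ℝ) ^ j * (1 / 20) ^ j) by ring, ← mul_pow]; norm_num
  have hj1 : (0 : ℝ) ≤ (j : ℝ) + 1 := by positivity
  rw [abs_mul, abs_mul, abs_mul, abs_mul, abs_pow, abs_of_nonneg hj1]
  split_ifs with h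
  · have hj200 : j + 1 ≤ 200 := by omega
    obtain ⟨hw, hz⟩ := abs_wz_le_MAJW2 hr hj200
    have ew : (getN MAJAW2 (j + 1) : ℝ) * ((10 : ℝ) ^ (j + 1) / (2 : ℝ) ^ 64) = ((hAQ (j + 1) : ℚ) : ℝ) * (10 : ℝ) ^ (j + 1) := by
      unfold hAQ; push_cast; ring
    have ez : (getN MAJBW2 (j + 1) : ℝ) * ((10 : ℝ) ^ (j + 1) / (2 : ℝ) ^ 64) = ((hBQ (j + 1) : ℚ) : ℝ) * (10 : ℝ) ^ (j + 1) := by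
      unfold hBQ; push_cast; ring
    rw [ew] at hw; rw [ez] at hz
    have hA0 : (0 : ℝ) ≤ ((hAQ (j + 1) : ℚ) : ℝ) := by unfold hAQ; push_cast; positivity
    have hB0 : (0 : ℝ) ≤ ((hBQ (j + 1) : ℚ) : ℝ) := by unfold hBQ; push_cast; positivity
    constructor
    · calc ((j : ℝ) + 1) * |w r (j + 1)| * |x| ^ j ≤ ((j : ℝ) + 1) * (((hAQ (j + 1) : ℚ) : ℝ) * (10 : ℝ) ^ (j + 1)) * (1 / 20 : ℝ) ^ j := by
            gcongr
        _ = _ := by rw [show ((j : ℝ) + 1) * (((hAQ (j + 1) : ℚ) : ℝ) * (10 : ℝ) ^ (j + 1)) * (1 / 20 : ℝ) ^ j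
              = ((j : ℝ) + 1) * ((hAQ (j + 1) : ℚ) : ℝ) * ((10 : ℝ) ^ (j + 1) * (1 / 20) ^ j) by ring, e10]; ring
    · calc ((j : ℝ) + 1) * |z r (j + 1)| * |x| ^ j ≤ ((j : ℝ) + 1) * (((hBQ (j + 1) : ℚ) : ℝ) * (10 : ℝ) ^ (j + 1)) * (1 / 20 : ℝ) ^ j := by
            gcongr
        _ = _ := by rw [show ((j : ℝ) + 1) * (((hBQ (j + 1) : ℚ) : ℝ) * (10 : ℝ) ^ (j + 1)) * (1 / 20 : ℝ) ^ j
              = ((j : ℝ) + 1) * ((hBQ (j + 1) : ℚ) : ℝ) * ((10 : ℝ) ^ (j + 1) * (1 / 20) ^ j) by ring, e10]; ring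
  · have hj60 : 60 < j + 1 := by omega
    obtain ⟨hw, hz⟩ := abs_wz_le_tail hr hj60
    push_cast at hw hz
    have hjR : (200 : ℝ) ≤ j := by exact_mod_cast (by omega : 200 ≤ j)
    have hjp : (0 : ℝ) < (j : ℝ) + 1 := by positivity
    have hj2 : (201 : ℝ) ^ 2 ≤ ((j : ℝ) + 1) ^ 2 := pow_le_pow_left₀ (by norm_num) (by linarith) 2
    have kw : ((j : ℝ) + 1) * ((1 / 800 : ℝ) / ((j : ℝ) + 1) ^ 3) ≤ 1 / 800 / 201 ^ 2 := by
      rw [show ((j : ℝ) + 1) * ((1 / 800 : ℝ) / ((j : ℝ) + 1) ^ 3) = 1 / 800 / ((j : ℝ) + 1) ^ 2 by field_simp]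
      exact div_le_div_of_nonneg_left (by norm_num) (by positivity) hj2
    have kz : ((j : ℝ) + 1) * ((7 / 20 : ℝ) / ((j : ℝ) + 1) ^ 3) ≤ 7 / 20 / 201 ^ 2 := by
      rw [show ((j : ℝ) + 1) * ((7 / 20 : ℝ) / ((j : ℝ) + 1) ^ 3) = 7 / 20 / ((j : ℝ) + 1) ^ 2 by field_simp]
      exact div_le_div_of_nonneg_left (by norm_num) (by positivity) hj2
    constructor
    · calc ((j : ℝ) + 1) * |w r (j + 1)| * |x| ^ j
          ≤ ((j : ℝ) + 1) * ((1 / 800 : ℝ) / ((j : ℝ) + 1) ^ 3 * (10 : ℝ) ^ (j + 1)) * (1 / 20 : ℝ) ^ j := by gcongr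
        _ = (((j : ℝ) + 1) * ((1 / 800 : ℝ) / ((j : ℝ) + 1) ^ 3)) * ((10 : ℝ) ^ (j + 1) * (1 / 20) ^ j) := by ring
        _ ≤ (1 / 800 / 201 ^ 2) * ((10 : ℝ) ^ (j + 1) * (1 / 20) ^ j) := mul_le_mul_of_nonneg_right kw (by positivity)
        _ = _ := by rw [e10]; ring
    · calc ((j : ℝ) + 1) * |z r (j + 1)| * |x| ^ j
          ≤ ((j : ℝ) + 1) * ((7 / 20 : ℝ) / ((j : ℝ) + 1) ^ 3 * (10 : ℝ) ^ (j + 1)) * (1 / 20 : ℝ) ^ j := by gcongr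
        _ = (((j : ℝ) + 1) * ((7 / 20 : ℝ) / ((j : ℝ) + 1) ^ 3)) * ((10 : ℝ) ^ (j + 1) * (1 / 20) ^ j) := by ring
        _ ≤ (7 / 20 / 201 ^ 2) * ((10 : ℝ) ^ (j + 1) * (1 / 20) ^ j) := mul_le_mul_of_nonneg_right kz (by positivity)
        _ = _ := by rw [e10]; ring

/-- **Tail of the value series after 26 terms**: for `r` in the window and `|x| ≤ 1/20`,
`|Wloc r x − Σ_{j<26} w_j x^j| ≤ tailWQ` and `|Zloc r x − Σ_{j<26} z_j x^j| ≤ tailZQ`.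
[cite: BuckmasterCaolaboraGomezserrano2025, Prop. 2.3, App. B] -/
theorem abs_WZloc_sub_head_le (hr : r ∈ Set.Icc ((13890041/12500000 : ℚ) : ℝ) ((697/625 : ℚ) : ℝ)) {x : ℝ} (hx : |x| ≤ 1 / 20) :
    |Wloc r x - ∑ j ∈ range 26, w r j * x ^ j| ≤ ((tailWQ : ℚ) : ℝ) ∧
      |Zloc r x - ∑ j ∈ range 26, z r j * x ^ j| ≤ ((tailZQ : ℚ) : ℝ) := by
  have hten : (0 : ℝ) < 10 := by norm_num
  have hw3 : ∀ n, |w r n| ≤ 3 * (10 : ℝ) ^ n := fun n => (abs_wz_le_three_pow hr n).1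
  have hz3 : ∀ n, |z r n| ≤ 3 * (10 : ℝ) ^ n := fun n => (abs_wz_le_three_pow hr n).2
  have hdisc : 10 * |x| < 1 := by linarith
  obtain ⟨hW, hZ⟩ := hasSum_Wloc_Zloc_of_bound hten hw3 hz3 hdisc
  have half0 : (0 : ℝ) ≤ 1 / 2 := by norm_num
  have half1 : (1 / 2 : ℝ) < 1 := by norm_num
  constructor
  · have hB := hasSum_data_then_geometric (fun i => ((hAQ (i + 26) : ℚ) : ℝ) * (1 / 2) ^ (i + 26)) 175
      (1 / 800 / 201 ^ 3 * (1 / 2) ^ 26) (1 / 2) half0 half1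
    have := abs_sub_partial_le (N := 26) hW (g := fun j => if j - 26 < 175 then ((hAQ j : ℚ) : ℝ) * (1 / 2) ^ j
        else 1 / 800 / 201 ^ 3 * (1 / 2) ^ j) (fun j hj => (abs_term_le_boundW hr hx hj).1) (B := _) (by
      convert hB using 1
      funext i
      simp only [Nat.add_sub_cancel]
      split_ifs <;> ring)
    refine this.trans (le_of_eq ?_)
    unfold tailWQ
    push_cast
    rw [sumQ_cast]
    push_cast
    ring
  · have hB := hasSum_data_then_geometric (fun i => ((hBQ (i + 26) : ℚ) : ℝ) * (1 / 2) ^ (i + 26)) 175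
      (7 / 20 / 201 ^ 3 * (1 / 2) ^ 26) (1 / 2) half0 half1
    have := abs_sub_partial_le (N := 26) hZ (g := fun j => if j - 26 < 175 then ((hBQ j : ℚ) : ℝ) * (1 / 2) ^ j
        else 7 / 20 / 201 ^ 3 * (1 / 2) ^ j) (fun j hj => (abs_term_le_boundW hr hx hj).2) (B := _) (by
      convert hB using 1
      funext i
      simp only [Nat.add_sub_cancel]
      split_ifs <;> ring)
    refine this.trans (le_of_eq ?_)
    unfold tailZQ
    push_cast
    rw [sumQ_cast]
    push_cast
    ring

/-- **Tail of the derivative series after 25 terms**: for `r` in the window and `|x| ≤ 1/20`,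
`|(Wloc r)′(x) − Σ_{j<25} (j+1) w_{j+1} x^j| ≤ dtailWQ` and the same for `Zloc` with `dtailZQ`.
[cite: BuckmasterCaolaboraGomezserrano2025, Prop. 2.3, App. B] -/
theorem abs_deriv_WZloc_sub_head_le (hr : r ∈ Set.Icc ((13890041/12500000 : ℚ) : ℝ) ((697/625 : ℚ) : ℝ)) {x : ℝ} (hx : |x| ≤ 1 / 20) :
    |deriv (Wloc r) x - ∑ j ∈ range 25, ((j : ℝ) + 1) * w r (j + 1) * x ^ j| ≤ ((dtailWQ : ℚ) : ℝ) ∧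
      |deriv (Zloc r) x - ∑ j ∈ range 25, ((j : ℝ) + 1) * z r (j + 1) * x ^ j| ≤ ((dtailZQ : ℚ) : ℝ) := by
  have hten : (0 : ℝ) < 10 := by norm_num
  have hw3 : ∀ n, |w r n| ≤ 3 * (10 : ℝ) ^ n := fun n => (abs_wz_le_three_pow hr n).1
  have hz3 : ∀ n, |z r n| ≤ 3 * (10 : ℝ) ^ n := fun n => (abs_wz_le_three_pow hr n).2
  have hdisc : 10 * |x| < 1 := by linarith
  have hW := hasSum_deriv_of_geom_bound hten hw3 hdisc
  have hZ := hasSum_deriv_of_geom_bound hten hz3 hdisc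
  rw [← Wloc_def] at hW
  rw [← Zloc_def] at hZ
  have half0 : (0 : ℝ) ≤ 1 / 2 := by norm_num
  have half1 : (1 / 2 : ℝ) < 1 := by norm_num
  constructor
  · have hB := hasSum_data_then_geometric (fun i => ((((i + 25 : ℕ) : ℝ) + 1) * ((hAQ (i + 25 + 1) : ℚ) : ℝ) * 10) * (1 / 2) ^ (i + 25)) 175
      (10 * (1 / 800) / 201 ^ 2 * (1 / 2) ^ 25) (1 / 2) half0 half1
    have := abs_sub_partial_le (N := 25) hW (g := fun j => if j - 25 < 175 then (((j : ℝ) + 1) * ((hAQ (j + 1) : ℚ) : ℝ) * 10) * (1 / 2) ^ j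
        else 10 * (1 / 800) / 201 ^ 2 * (1 / 2) ^ j) (fun j hj => (abs_dterm_le_boundW hr hx hj).1) (B := _) (by
      convert hB using 1
      funext i
      simp only [Nat.add_sub_cancel]
      split_ifs <;> ring)
    refine this.trans (le_of_eq ?_)
    unfold dtailWQ
    push_cast
    rw [sumQ_cast]
    push_cast
    refine congrArg₂ (· + ·) (sum_congr rfl fun i _ => ?_) (by ring)
    ring
  · have hB := hasSum_data_then_geometric (fun i => ((((i + 25 : ℕ) : ℝ) + 1) * ((hBQ (i + 25 + 1) : ℚ) : ℝ) * 10) * (1 / 2) ^ (i + 25)) 175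
      (10 * (7 / 20) / 201 ^ 2 * (1 / 2) ^ 25) (1 / 2) half0 half1
    have := abs_sub_partial_le (N := 25) hZ (g := fun j => if j - 25 < 175 then (((j : ℝ) + 1) * ((hBQ (j + 1) : ℚ) : ℝ) * 10) * (1 / 2) ^ j
        else 10 * (7 / 20) / 201 ^ 2 * (1 / 2) ^ j) (fun j hj => (abs_dterm_le_boundW hr hx hj).2) (B := _) (by
      convert hB using 1
      funext i
      simp only [Nat.add_sub_cancel]
      split_ifs <;> ring)
    refine this.trans (le_of_eq ?_)
    unfold dtailZQ
    push_cast
    rw [sumQ_cast]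
    push_cast
    refine congrArg₂ (· + ·) (sum_congr rfl fun i _ => ?_) (by ring)
    ring

/-! ### r-uniform start boxes: Taylor models of the series values and derivatives at a rational `c`, `|c| ≤ 1/20` -/

section Boxes

open Literature.Analysis.ValidatedNumerics Literature.Analysis.ValidatedNumerics.PolyMP
open Literature.Analysis.ValidatedNumerics.NumericsMP
open OriginSeries (tsumI tmem_tsumI ent)

/-- Product of a model with a rational constant `q = num/den`. [folklore] -/
def tscaleQ (q : ℚ) (P : IPoly) : IPoly := tdivNat q.den (tsmulInt q.num P)

/-- [folklore] -/
theorem tmem_tscaleQ {S : ℕ} {h : ℚ} {f : ℝ → ℝ} {P : IPoly} (q : ℚ) (hf : TMem S h f P) :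
    TMem S h (fun ρ => (q : ℝ) * f ρ) (tscaleQ q P) := by
  have := tmem_divNat (n := q.den) q.pos (tmem_smulInt q.num hf)
  refine (show (fun ρ => (q : ℝ) * f ρ) = _ from ?_) ▸ this
  funext ρ
  rw [Rat.cast_def q]
  ring

/-- Model of the head value `Σ_{j<n} F_j c^j` from the models of the coefficients. [folklore] -/
def headValTM (S : ℕ) (L : List IPoly) (c : ℚ) (n : ℕ) : IPoly := tsumI S (fun j => tscaleQ (c ^ j) (ent S L j)) n

/-- Model of the head derivative `Σ_{j<n} (j+1) F_{j+1} c^j`. [folklore] -/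
def headDerTM (S : ℕ) (L : List IPoly) (c : ℚ) (n : ℕ) : IPoly :=
  tsumI S (fun j => tscaleQ (((j : ℚ) + 1) * c ^ j) (ent S L (j + 1))) n

/-- [folklore] -/
theorem tmem_headValTM {S : ℕ} {h : ℚ} {F : ℝ → ℕ → ℝ} {L : List IPoly} {c : ℚ} {n : ℕ}
    (hL : ∀ j, j < n → TMem S h (fun ρ => F ρ j) (ent S L j)) :
    TMem S h (fun ρ => ∑ j ∈ range n, F ρ j * (c : ℝ) ^ j) (headValTM S L c n) := by
  unfold headValTM
  refine tmem_tsumI n fun j hj => ?_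
  have := tmem_tscaleQ (c ^ j) (hL j hj)
  refine (show (fun ρ => F ρ j * (c : ℝ) ^ j) = _ from ?_) ▸ this
  funext ρ; push_cast; ring

/-- [folklore] -/
theorem tmem_headDerTM {S : ℕ} {h : ℚ} {F : ℝ → ℕ → ℝ} {L : List IPoly} {c : ℚ} {n : ℕ}
    (hL : ∀ j, j < n → TMem S h (fun ρ => F ρ (j + 1)) (ent S L (j + 1))) :
    TMem S h (fun ρ => ∑ j ∈ range n, ((j : ℝ) + 1) * F ρ (j + 1) * (c : ℝ) ^ j) (headDerTM S L c n) := by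
  unfold headDerTM
  refine tmem_tsumI n fun j hj => ?_
  have := tmem_tscaleQ (((j : ℚ) + 1) * c ^ j) (hL j hj)
  refine (show (fun ρ => ((j : ℝ) + 1) * F ρ (j + 1) * (c : ℝ) ^ j) = _ from ?_) ▸ this
  funext ρ; push_cast; ring

/-- Folding a uniformly small perturbation into the constant coefficient of a model. [folklore] -/
theorem tmem_widen0 {S : ℕ} {h : ℚ} {f g : ℝ → ℝ} {P : IPoly} {e : ℤ} (hf : TMem S h f P)
    (hfg : ∀ ρ : ℝ, |ρ| ≤ (h : ℝ) → |g ρ - f ρ| * S ≤ e) : TMem S h g (widen0 P e) := fun ρ hρ => by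
  obtain ⟨as, has, ef⟩ := hf ρ hρ
  obtain ⟨bs, hbs, eb⟩ := exists_widen0 has (hfg ρ hρ) ρ
  exact ⟨bs, hbs, by rw [eb, ← ef]; ring⟩

/-- `|ρ| ≤ hw` puts `r_m + ρ` in the window. [folklore] -/
theorem mem_window_of_abs_le {ρ : ℝ} (hρ : |ρ| ≤ ((hwSW2 : ℚ) : ℝ)) :
    ((rmSW2 : ℚ) : ℝ) + ρ ∈ Set.Icc ((13890041/12500000 : ℚ) : ℝ) ((697/625 : ℚ) : ℝ) := by
  have e1 : ((rmSW2 : ℚ) : ℝ) = 27830041 / 25000000 := by unfold rmSW2; push_cast; ring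
  have e2 : ((hwSW2 : ℚ) : ℝ) = 49959 / 25000000 := by unfold hwSW2; push_cast; ring
  rw [e2, abs_le] at hρ
  rw [e1]
  constructor <;> push_cast <;> linarith [hρ.1, hρ.2]

/-- The scaled widening of a rational tail constant. [folklore] -/
def tailE (t : ℚ) : ℤ := ⌈t * (2 : ℚ) ^ 100⌉

/-- [folklore] -/
theorem mul_S_le_tailE {x : ℝ} {t : ℚ} (hx : |x| ≤ ((t : ℚ) : ℝ)) : |x| * (SSW2 : ℕ) ≤ (tailE t : ℝ) := by
  have h1 : ((t * (2 : ℚ) ^ 100 : ℚ) : ℝ) ≤ ((tailE t : ℤ) : ℝ) := by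
    unfold tailE; exact_mod_cast Int.le_ceil _
  push_cast at h1
  have hS : ((SSW2 : ℕ) : ℝ) = (2 : ℝ) ^ 100 := by unfold SSW2; push_cast; ring
  rw [hS]
  nlinarith [pow_pos (show (0:ℝ) < 2 by norm_num) 100]

/-- **Start boxes, values**: for a rational `c` with `|c| ≤ 1/20`, Taylor models in `ρ = r − r_m` of `Wloc r c` and `Zloc r c` valid on the
whole window. [cite: BuckmasterCaolaboraGomezserrano2025, Prop. 2.3, App. B] -/
theorem tmem_WZloc_val (c : ℚ) (hc : |c| ≤ 1 / 20) :
    TMem SSW2 hwSW2 (fun ρ => Wloc (((rmSW2 : ℚ) : ℝ) + ρ) c) (widen0 (headValTM SSW2 LWSW2 c 26) (tailE tailWQ)) ∧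
      TMem SSW2 hwSW2 (fun ρ => Zloc (((rmSW2 : ℚ) : ℝ) + ρ) c) (widen0 (headValTM SSW2 LZSW2 c 26) (tailE tailZQ)) := by
  have hcR : |((c : ℚ) : ℝ)| ≤ 1 / 20 := by
    have := (Rat.cast_le (K := ℝ)).mpr hc; push_cast at this; exact this
  have hW := tmem_headValTM (S := SSW2) (h := hwSW2) (c := c) (n := 26) (F := fun ρ j => w (((rmSW2 : ℚ) : ℝ) + ρ) j)
    (L := LWSW2) (fun j hj => (tmem_LSW2 (i := j) (by omega)).1)
  have hZ := tmem_headValTM (S := SSW2) (h := hwSW2) (c := c) (n := 26) (F := fun ρ j => z (((rmSW2 : ℚ) : ℝ) + ρ) j)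
    (L := LZSW2) (fun j hj => (tmem_LSW2 (i := j) (by omega)).2)
  constructor
  · refine tmem_widen0 hW fun ρ hρ => mul_S_le_tailE ?_
    exact (abs_WZloc_sub_head_le (mem_window_of_abs_le hρ) hcR).1
  · refine tmem_widen0 hZ fun ρ hρ => mul_S_le_tailE ?_
    exact (abs_WZloc_sub_head_le (mem_window_of_abs_le hρ) hcR).2

/-- **Start boxes, derivatives**: Taylor models in `ρ` of `(Wloc r)′(c)` and `(Zloc r)′(c)`, `|c| ≤ 1/20`, on the whole window.
[cite: BuckmasterCaolaboraGomezserrano2025, Prop. 2.3, App. B] -/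
theorem tmem_deriv_WZloc_val (c : ℚ) (hc : |c| ≤ 1 / 20) :
    TMem SSW2 hwSW2 (fun ρ => deriv (Wloc (((rmSW2 : ℚ) : ℝ) + ρ)) c) (widen0 (headDerTM SSW2 LWSW2 c 25) (tailE dtailWQ)) ∧
      TMem SSW2 hwSW2 (fun ρ => deriv (Zloc (((rmSW2 : ℚ) : ℝ) + ρ)) c) (widen0 (headDerTM SSW2 LZSW2 c 25) (tailE dtailZQ)) := by
  have hcR : |((c : ℚ) : ℝ)| ≤ 1 / 20 := by
    have := (Rat.cast_le (K := ℝ)).mpr hc; push_cast at this; exact this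
  have hW := tmem_headDerTM (S := SSW2) (h := hwSW2) (c := c) (n := 25) (F := fun ρ j => w (((rmSW2 : ℚ) : ℝ) + ρ) j)
    (L := LWSW2) (fun j hj => (tmem_LSW2 (i := j + 1) (by omega)).1)
  have hZ := tmem_headDerTM (S := SSW2) (h := hwSW2) (c := c) (n := 25) (F := fun ρ j => z (((rmSW2 : ℚ) : ℝ) + ρ) j)
    (L := LZSW2) (fun j hj => (tmem_LSW2 (i := j + 1) (by omega)).2)
  constructor
  · refine tmem_widen0 hW fun ρ hρ => mul_S_le_tailE ?_
    exact (abs_deriv_WZloc_sub_head_le (mem_window_of_abs_le hρ) hcR).1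
  · refine tmem_widen0 hZ fun ρ hρ => mul_S_le_tailE ?_
    exact (abs_deriv_WZloc_sub_head_le (mem_window_of_abs_le hρ) hcR).2

end Boxes

end SW2

end SonicSeries

end Monatomic

end BuckmasterCaolaboraGomezserrano2025

end Literature.Analysis.FluidPDE
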